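import Summits.CriticalPhenomena.PercolationContinuityZ3.Theorems.PercNearOneGluingNoHeavyLowerTailLinearInclusiveCex
import Summits.CriticalPhenomena.PercolationContinuityZ3.Theorems.PercNearOneGluingNoHeavyQuantLowerTailGluing
import HarnessLib

/-!
# QUANT lane R1: the constant of the linear lower tail cannot go below `1` — `¬ QuantLowerTailGluing C` for every `C < 1`

Support file (`--supports stmt-CriticalPhenomena-4575`, computational: three rational facts by `native_decide`), seat `prim-quant-p1` (rung R1);
builds on p205010 (kernel theorem, internal audit signed; external expert review pending).  No definitions, no named facts, no sorries.

With `QuantGluing.quantLowerTailGluing_two` (`QuantLowerTailGluing 2`, p207336) this pins the sharp constant `C*` of QUANT.md §5's Q-AG1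
(`P(1 ≤ N < EN/2) ≤ C·(P(o ↮ A) + max_{a,a'} P(a ↮ a'))` on every finite weighted graph) to the interval `[1, 2]`; the exact value is the
census seat's question.  The witness family behind the lower end (seat census `work/census/qag1_search.py`: hill climbs converge to ratio `1⁻`
and never above): an observer glued to one relay `a₀`, a glued block `G` of `k ≥ 2` further relays, and a single link `o – G` of weight
`x ∈ (1/k, 1)`; then `N = 1` with probability `1 − x`, `EN = 1 + kx > 2`, `P(o ↮ A) = 0` and `max P(a ↮ a') = 1 − x`: EQUALITY at `C = 1`.
The instance used here: `k = 2`, `x = 3/4` on four vertices — pairs `{0,1}` (weight `1`), `{2,3}` (weight `1`), `{0,2}` (weight `3/4`),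
`o = 0`, `A = {1, 2, 3}`: `P(1 ≤ N < EN/2) = 1/4`, `EN = 5/2`, `P(o ↮ A) = 0`, `P(a ↮ a') ≤ 1/4`.

* `quantLowerTailGluing_false_of_lt_one` — `∀ C < 1, ¬ Quant.QuantLowerTailGluing C`.
Method: the exact-rational weighted machinery of `CertWeighted.lean` / `…LinearInclusiveCex.lean` (`prodBernoulli_real_eq_wsum`, `wConn`,
`wNotConn`, `linIncCex_le_real_lowCount`); on this instance `{1 ≤ N ∧ 2N ≤ |A|} ⊆ {1 ≤ N ∧ N < EN/2}` because `|A| = 3` and `EN = 5/2 > 2`.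
[cite: KozmaNitzan2024, Conjecture 3 (p. 15) and Conj. 1 (p. 3)]
-/

namespace Summit.CriticalPhenomena.PercolationContinuityZ3.Theorems

open MeasureTheory
open Literature.Probability.LatticeModels Literature.Probability.Percolation
open Summit.CriticalPhenomena.PercolationContinuityZ3.Theorems.AdditiveGluing.Negative.Cert

namespace QuantGluing

/-- The four-vertex witness: pairs `{0,1}`, `{2,3}` of weight `1` and `{0,2}` of weight `3/4`. [folklore] -/
theorem sharpOne_wlist_nodup :
    (wPairs ([((0 : Fin 4), (1 : Fin 4), (1 : ℚ)), (2, 3, 1), (0, 2, 3/4)] : List (Fin 4 × Fin 4 × ℚ))).Nodup := by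
  decide

/-- The witness weights lie in `[0, 1]`. [folklore] -/
theorem sharpOne_wlist_unit :
    ∀ e ∈ ([((0 : Fin 4), (1 : Fin 4), (1 : ℚ)), (2, 3, 1), (0, 2, 3/4)] : List (Fin 4 × Fin 4 × ℚ)), 0 ≤ e.2.2 ∧ e.2.2 ≤ 1 := by
  intro e he
  simp only [List.mem_cons, List.mem_nil_iff, or_false] at he
  rcases he with rfl | rfl | rfl <;> norm_num

open Classical in
/-- **The linear lower tail needs `C ≥ 1`**: for every `C < 1`, `QuantLowerTailGluing C` (Q-AG1 at threshold `EN/2` with constant `C`) FAILS,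
witnessed by the four-vertex weighted graph above with `o = 0`, `A = {1, 2, 3}`, `s = 1/4`:
`P(1 ≤ N < EN/2) = 1/4 > C·(P(o ↮ A) + 1/4) = C/4`.  Together with `quantLowerTailGluing_two` the sharp constant lies in `[1, 2]`.
[cite: KozmaNitzan2024, Conjecture 3 (p. 15)] -/
theorem quantLowerTailGluing_false_of_lt_one (C : ℝ) (hC : C < 1) : ¬ Quant.QuantLowerTailGluing C := by
  intro h
  set l : List (Fin 4 × Fin 4 × ℚ) := [((0 : Fin 4), (1 : Fin 4), (1 : ℚ)), (2, 3, 1), (0, 2, 3/4)] with hl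
  have hnd : (wPairs l).Nodup := sharpOne_wlist_nodup
  have hq : ∀ e ∈ l, 0 ≤ e.2.2 ∧ e.2.2 ≤ 1 := sharpOne_wlist_unit
  set A : Finset (Fin 4) := {1, 2, 3} with hA
  set μ := prodBernoulli (wOfList l) with hμ
  -- the instance of `QuantLowerTailGluingAt (1/2) C`
  have hs : ∀ a ∈ A, ∀ a' ∈ A, μ.real (openConn a a')ᶜ ≤ (1 / 4 : ℝ) := by
    intro a ha a' ha'
    rw [hμ, real_compl_openConn_eq_wNotConn hnd hq a a']
    have key : ∀ a ∈ A, ∀ a' ∈ A, wNotConn (wtabs 4 l) a a' ≤ 1 / 4 := by native_decide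
    have h' := (Rat.cast_le (K := ℝ)).2 (key a ha a' ha')
    have e : ((1 / 4 : ℚ) : ℝ) = 1 / 4 := by norm_num
    rwa [e] at h'
  have hinst := h 4 (wOfList l) A 0 (1 / 4) (by decide) (by norm_num) hs
  rw [← hμ] at hinst
  -- `P(o ↮ A) = 0`
  have hUA : μ.real (⋃ a ∈ A, openConn (0 : Fin 4) a)ᶜ ≤ 0 := by
    calc μ.real (⋃ a ∈ A, openConn (0 : Fin 4) a)ᶜ
        ≤ μ.real (openConn (0 : Fin 4) (1 : Fin 4))ᶜ :=
          measureReal_mono (Set.compl_subset_compl.2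
            (Set.subset_iUnion₂ (s := fun x (_ : x ∈ A) => openConn (0 : Fin 4) x) (1 : Fin 4) (by decide)))
      _ = (wNotConn (wtabs 4 l) 0 1 : ℝ) := by rw [hμ]; exact real_compl_openConn_eq_wNotConn hnd hq 0 1
      _ = 0 := by
          have : wNotConn (wtabs 4 l) 0 1 = 0 := by native_decide
          rw [this, Rat.cast_zero]
  -- `EN = 5/2`
  have hEN : ∑ a ∈ A, μ.real (openConn (0 : Fin 4) a) = 5 / 2 := by
    have hc : ∀ a : Fin 4, μ.real (openConn (0 : Fin 4) a) = (wConn (wtabs 4 l) 0 a : ℝ) := fun a => by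
      rw [hμ]; exact real_openConn_eq_wConn hnd hq 0 a
    have h1 : wConn (wtabs 4 l) 0 ((1 : Fin 4) : ℕ) = 1 := by native_decide
    have h2 : wConn (wtabs 4 l) 0 ((2 : Fin 4) : ℕ) = 3 / 4 := by native_decide
    have h3 : wConn (wtabs 4 l) 0 ((3 : Fin 4) : ℕ) = 3 / 4 := by native_decide
    rw [hA, Finset.sum_insert (by decide), Finset.sum_insert (by decide), Finset.sum_singleton, hc, hc, hc, h1, h2, h3]
    push_cast
    norm_num
  -- `P(1 ≤ N ∧ 2N ≤ |A|) ≥ 1/4`, and that event lies in `{1 ≤ N ∧ N < EN/2}`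
  have hlow : ((1 / 4 : ℚ) : ℝ) ≤ μ.real {ω | 1 ≤ (A.filter fun x => ω ∈ openConn (0 : Fin 4) x).card ∧
      2 * (A.filter fun x => ω ∈ openConn (0 : Fin 4) x).card ≤ A.card} := by
    rw [hμ]
    refine linIncCex_le_real_lowCount hnd hq 0 A ?_
    native_decide
  have hcard : A.card = 3 := by rw [hA]; decide
  have hsub : {ω | 1 ≤ (A.filter fun x => ω ∈ openConn (0 : Fin 4) x).card ∧
        2 * (A.filter fun x => ω ∈ openConn (0 : Fin 4) x).card ≤ A.card} ⊆
      {ω | 1 ≤ (A.filter fun a => ω ∈ openConn (0 : Fin 4) a).card ∧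
        ((A.filter fun a => ω ∈ openConn (0 : Fin 4) a).card : ℝ) <
          1 / 2 * ∑ a ∈ A, μ.real (openConn (0 : Fin 4) a)} := by
    intro ω hω
    obtain ⟨h1, h2⟩ := hω
    refine ⟨h1, ?_⟩
    rw [hEN]
    rw [hcard] at h2
    have h3 : (A.filter fun a => ω ∈ openConn (0 : Fin 4) a).card ≤ 1 := by omega
    have h4 : ((A.filter fun a => ω ∈ openConn (0 : Fin 4) a).card : ℝ) ≤ 1 := by exact_mod_cast h3
    linarith
  have hE := (measureReal_mono hsub (measure_ne_top μ _)).trans' hlow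
  have hq14 : ((1 / 4 : ℚ) : ℝ) = 1 / 4 := by norm_num
  rw [hq14] at hE
  -- contradiction
  have hUA0 : 0 ≤ μ.real (⋃ a ∈ A, openConn (0 : Fin 4) a)ᶜ := measureReal_nonneg
  nlinarith [hinst, hE, hUA, hUA0]

/-- **Positive form**: any constant `C` for which Q-AG1 (`QuantLowerTailGluing C`) holds on every finite weighted graph satisfies `1 ≤ C`.
[cite: KozmaNitzan2024, Conjecture 3 (p. 15)] -/
theorem one_le_of_quantLowerTailGluing {C : ℝ} (h : Quant.QuantLowerTailGluing C) : 1 ≤ C := by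
  by_contra hlt
  exact quantLowerTailGluing_false_of_lt_one C (not_le.1 hlt) h

/-- **A named refuted instance**: `QuantLowerTailGluing (1/2)` is false (so the typed conjecture family has refuted members below `1`
and a proved member at `2`). [cite: KozmaNitzan2024, Conjecture 3 (p. 15)] -/
theorem quantLowerTailGluing_half_false : ¬ Quant.QuantLowerTailGluing (1 / 2) :=
  quantLowerTailGluing_false_of_lt_one (1 / 2) (by norm_num)

end QuantGluing

end Summit.CriticalPhenomena.PercolationContinuityZ3.Theorems
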